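import Mathlib

/-!
# Route BarrierLever — item `PartitionMinorsHitByVP` (stmt-ValiantsHypothesis-19717):
# the CUBE-HALVING and PERFECT-HYPERPLANE-SHATTERING statements (definitions only)

Definitions file (`--supports stmt-ValiantsHypothesis-19717`; cell valiant-natproofs, rung V4, 𝒟-side door (c);
prover seat val-np-p1 gen 9; typed Theorems-side per director-valiant g6's ruling 2026-08-27T06:51Z (B): candidate
combinatorial lemmas are `def … : Prop` here + a finite falsifier, NOT route items). No theorem is asserted.

* **`CubeHalving h κ`** — the HALVING / EVEN-SPLIT LEMMA at height `h`, size `2^κ` (`κ ≥ 1`): every family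
  `𝒰` of `2^κ` distinct subsets of `Fin h` contains a sub-family `Z` of size `2^(κ-1)` cut out EXACTLY by a
  complex (equivalently rational) affine functional `U ↦ Σ_{k∈U} a k − t` — i.e. some affine hyperplane of
  `ℚ^h` contains exactly half of the `0/1` points `{1_U : U ∈ 𝒰}`. Conjectured for all `h, κ` (val-np-p1 g9
  memo F2-MEMO-valnp1-g9.md §3; val-np-p3 g4's ESL, proved by hand for `κ ≤ 3`); numerically: no failure for
  `h ≤ 6` (kit j271111, j270989; exhaustive over all `2^κ`-subsets of `{0,1}^4`); needs genuinely skew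
  hyperplanes (faces of the cube do NOT suffice at `h = 5`) and genuinely powers of two (`10`-point sets
  without a `5`-point section exist in `{0,1}^4`). `∀ κ' ≤ κ, CubeHalving h κ'` makes every `2^κ`-family
  `SubsetSum.IsSplittable κ` (bridge in the companion classes file), hence — through
  `SubsetSum.partitionMinor_hit_of_isSplittable_face` — puts every layout «`2^κ` arbitrary rows × a
  `κ`-dimensional FACE of columns» of item 19717 inside `SmallCircuits ℂ (h+h) 5`.
* **`PerfectHyperplaneShattering h κ`** — the stronger explicit form: `κ` affine functionals whose zero/non-zero
  pattern on `𝒰` is a BIJECTION onto the bit-vectors. TRUE for every subset of `{0,1}^3`, `{0,1}^4` (exhaustive)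
  but numerically FALSE at `(h, κ) = (5, 4)` (kit j271111: 114 of 1 496 random `16`-subsets of `{0,1}^5` admit
  no perfect shattering) — recorded so that nobody builds on it; the generic-table engine
  `SubsetSum.det_ssv_ne_zero` does not need it.

WHAT THIS IS NOT: no proof or refutation of either statement in the kernel; nothing on crux 14610.
-/

set_option linter.dupNamespace false

namespace Summit.ValiantsHypothesis.ValiantsHypothesis.Theorems.BarrierLever.SubsetSum

open Finset

/-- **CUBE HALVING** at height `h`, size `2^κ`: every family of `2^κ` distinct subsets of `Fin h` has a
sub-family of size `2^(κ-1)` that is EXACTLY the zero set (within the family) of an affine functional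
`U ↦ Σ_{k ∈ U} a k - t`. (Intended for `κ ≥ 1`; at `κ = 0` it asks for `Z.card = 1`, which holds with
`Z = 𝒰`, `a = 0`, `t = 0`.) -/
def CubeHalving (h κ : ℕ) : Prop :=
  ∀ 𝒰 : Finset (Finset (Fin h)), 𝒰.card = 2 ^ κ →
    ∃ Z : Finset (Finset (Fin h)), Z ⊆ 𝒰 ∧ Z.card = 2 ^ (κ - 1) ∧
      ∃ (a : Fin h → ℂ) (t : ℂ), ∀ U ∈ 𝒰, (∑ k ∈ U, a k = t ↔ U ∈ Z)

/-- **PERFECT HYPERPLANE SHATTERING** at height `h`, size `2^κ`: every family of `2^κ` distinct subsets of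
`Fin h` admits `κ` affine functionals `U ↦ Σ_{k∈U} a c k - t c` whose zero pattern `U ↦ (c ↦ [Σ a c = t c])`
is a bijection from the family onto the bit-vectors `Fin κ → Bool`. (Numerically false at `(5, 4)`; see the
module docstring.) -/
def PerfectHyperplaneShattering (h κ : ℕ) : Prop :=
  ∀ 𝒰 : Finset (Finset (Fin h)), 𝒰.card = 2 ^ κ →
    ∃ (a : Fin κ → Fin h → ℂ) (t : Fin κ → ℂ),
      Set.BijOn (fun U : Finset (Fin h) => fun c : Fin κ => decide (∑ k ∈ U, a c k = t c))
        (↑𝒰 : Set (Finset (Fin h))) Set.univ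

end Summit.ValiantsHypothesis.ValiantsHypothesis.Theorems.BarrierLever.SubsetSum
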